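import Mathlib
import Summits.NavierStokesRegularity.NavierStokesRegularity.Theorems.WakeRatchetTailRatchetPeakDelaySelfDrain
import HarnessLib

/-!
# `WakeRatchet.TailRatchet` (stmt-NavierStokesRegularity-21808), door D4′ — peak delay from MUTUAL levels, and the
# look-ahead bound (S) from the leading edge: the input (S) of the rising-chain reduction is not independent

Def-free support lemmas (`--supports stmt-NavierStokesRegularity-21808`), continuing
`WakeRatchetTailRatchetPeakDelaySelfDrain` (p840465: a rising shell of the dyadic cascade holding the renormalised level
`c` feeds its own drain and comes down within `x ≤ 2 + 4ΛK²/c³` of the clock, GIVEN the look-ahead bound (S)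
`ΛXₖ₊₁Xₖ₊₂ ≤ Xₖ²/2`).  Along the one-shell cascade the window `[t, pₖ]` on which shell `k` rises splits at the first
firing `sₖ₊₁` of the shell above:

* BEFORE `sₖ₊₁` the tree's unconditional LEADING EDGE (`WakeRatchetDyadicPostFiring.cauchy_firstFiring_clock`, p839816:
  `W_{N+1+i} ≤ Λ⁻¹(Λc₀)^{2^i}` on `[s_N, s_{N+1})`) bounds the two shells above by `c₀` and `Λc₀²`, and
  `lookahead_of_leadingEdge` turns that into (S) as soon as shell `k` holds a level `c` with `c₁c₂ ≤ Λ²c²/2`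
  (for `c = c₀`: `c₀ ≤ Λ/2`, always true) — so (S) is DERIVED on the pre-firing part;
* AFTER `sₖ₊₁` the shell above is itself at level `≥ c′` (level maintenance (L) for shell `k+1`), and NO look-ahead is
  needed: the drain `Λ⁻¹uₖuₖ₊₁ ≥ Λ⁻¹cc′(T−τ)⁻²` alone forces `Λ⁻¹cc′(x − 1) ≤ F(p−a)(T−a)` (`coexist_cost_le_feed`), i.e.
  two shells cannot BOTH hold renormalised levels while the lower one keeps rising for more than
  `x ≤ 1 + Λ²K²/(cc′)` of the clock (`dyadic_coexist_bottom_shell`, with the type-I bound `K` for the peaked shell below).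

Upshot for the census of stmt-21808 (door D4′): in the rising-chain reduction
`WakeRatchetPeakDelaySelfDrain.cauchyPostFiringBound_of_risingChain` the look-ahead input (S) can be replaced by the
tree's leading edge + level maintenance (L) of the next shell; the remaining inputs are (U) unimodality, (O) ordered
peaks, (L) level maintenance from first firing to peak, (B) bounded rising chain.

HONEST FRAMING: MODEL lattice ODEs (scalar dyadic member of Tao 2016 §1.2/§4); elementary real analysis; (U), (O), (L),
(B), (R′), (D) are NOT proved here, stmt-21808 is neither proved nor refuted, no stub of skeleton d00b85951d7c is closed.
-/

noncomputable section

set_option linter.dupNamespace false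

namespace Summit.NavierStokesRegularity.NavierStokesRegularity.Theorems

namespace WakeRatchetPeakDelaySelfDrain

open Set

/-- **Coexistence costs feed.**  On `[a,p]` (`a ≤ p < T`) let `v' ≤ F − Λ⁻¹ v w` with `v ≥ c/(T−τ)`, `w ≥ c′/(T−τ)`
(`c, c′ ≥ 0`, `Λ > 0`) and suppose `v(a) ≤ v(p)`.  Then with `x = (T−a)/(T−p)`: `Λ⁻¹cc′(x − 1) ≤ F(p − a)(T − a)`.
[cite: Tao2016AveragedNS, §1.2 (dyadic model); elementary real analysis (door D4′ of stmt-21808)] -/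
theorem coexist_cost_le_feed {v w dv : ℝ → ℝ} {Λ F c c' T a p : ℝ} (hΛ : 0 < Λ) (hc : 0 ≤ c) (hc' : 0 ≤ c')
    (hap : a ≤ p) (hpT : p < T)
    (hv : ∀ τ ∈ Icc a p, HasDerivAt v (dv τ) τ)
    (hdv : ∀ τ ∈ Icc a p, dv τ ≤ F - Λ⁻¹ * v τ * w τ)
    (hlev : ∀ τ ∈ Icc a p, c / (T - τ) ≤ v τ) (hlev' : ∀ τ ∈ Icc a p, c' / (T - τ) ≤ w τ)
    (hend : v a ≤ v p) :
    Λ⁻¹ * c * c' * ((T - a) / (T - p) - 1) ≤ F * (p - a) * (T - a) := by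
  have hTa : 0 < T - a := by linarith
  have hTp : 0 < T - p := by linarith
  -- θ τ := v τ - F τ + Λ⁻¹ c c' (T-τ)⁻¹ is antitone on [a,p]
  set θ : ℝ → ℝ := fun τ => v τ - F * τ + Λ⁻¹ * c * c' * (T - τ)⁻¹ with hθ
  have hsub : ∀ τ : ℝ, HasDerivAt (fun y => T - y) (-1) τ := fun τ => by
    simpa using (hasDerivAt_id τ).const_sub T
  have hinv : ∀ τ ∈ Icc a p, HasDerivAt (fun y => (T - y)⁻¹) ((T - τ)⁻¹ ^ 2) τ := by
    intro τ hτ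
    have hne : T - τ ≠ 0 := by linarith [hτ.2]
    have h := ((hsub τ).inv hne).congr_deriv (by rw [neg_neg, one_div, ← inv_pow])
    exact h
  have hθ' : ∀ τ ∈ Icc a p, HasDerivAt θ (dv τ - F + Λ⁻¹ * c * c' * (T - τ)⁻¹ ^ 2) τ := by
    intro τ hτ
    have h1 : HasDerivAt (fun y => F * y) F τ := by simpa using (hasDerivAt_id τ).const_mul F
    have h := ((hv τ hτ).sub h1).add ((hinv τ hτ).const_mul (Λ⁻¹ * c * c'))
    exact h.congr_of_eventuallyEq (Filter.Eventually.of_forall fun y => by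
      simp only [hθ, Pi.add_apply, Pi.sub_apply])
  have hcont : ContinuousOn θ (Icc a p) := fun τ hτ => (hθ' τ hτ).continuousAt.continuousWithinAt
  have hanti : AntitoneOn θ (Icc a p) := by
    refine antitoneOn_of_hasDerivWithinAt_nonpos
      (f' := fun τ => dv τ - F + Λ⁻¹ * c * c' * (T - τ)⁻¹ ^ 2) (convex_Icc a p) hcont ?_ ?_
    · intro τ hτ
      rw [interior_Icc] at hτ
      exact (hθ' τ (Ioo_subset_Icc_self hτ)).hasDerivWithinAt
    · intro τ hτ
      rw [interior_Icc] at hτ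
      have hτ' : τ ∈ Icc a p := Ioo_subset_Icc_self hτ
      have hTτ : 0 < T - τ := by linarith [hτ.2]
      have hv1 : c / (T - τ) ≤ v τ := hlev τ hτ'
      have hw1 : c' / (T - τ) ≤ w τ := hlev' τ hτ'
      have ha0 : 0 ≤ c / (T - τ) := div_nonneg hc hTτ.le
      have hb0 : 0 ≤ c' / (T - τ) := div_nonneg hc' hTτ.le
      have hprod : c / (T - τ) * (c' / (T - τ)) ≤ v τ * w τ := mul_le_mul hv1 hw1 hb0 (ha0.trans hv1)
      have hΛinv : 0 < Λ⁻¹ := inv_pos.2 hΛ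
      have hkey : Λ⁻¹ * (c / (T - τ) * (c' / (T - τ))) = Λ⁻¹ * c * c' * (T - τ)⁻¹ ^ 2 := by
        field_simp
      have h2 : Λ⁻¹ * (c / (T - τ) * (c' / (T - τ))) ≤ Λ⁻¹ * (v τ * w τ) :=
        mul_le_mul_of_nonneg_left hprod hΛinv.le
      rw [hkey] at h2
      have h1 := hdv τ hτ'
      have h3 : dv τ ≤ F - Λ⁻¹ * (v τ * w τ) := by rw [mul_assoc] at h1; exact h1
      linarith
  have ha : a ∈ Icc a p := left_mem_Icc.2 hap
  have hp : p ∈ Icc a p := right_mem_Icc.2 hap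
  have hθap : θ p ≤ θ a := hanti ha hp hap
  simp only [hθ] at hθap
  have hx : (T - a) / (T - p) = (T - a) * (T - p)⁻¹ := div_eq_mul_inv _ _
  rw [hx]
  have key : Λ⁻¹ * c * c' * ((T - p)⁻¹ - (T - a)⁻¹) ≤ F * (p - a) := by nlinarith
  have key2 := mul_le_mul_of_nonneg_right key hTa.le
  have expand : Λ⁻¹ * c * c' * ((T - p)⁻¹ - (T - a)⁻¹) * (T - a)
      = Λ⁻¹ * c * c' * ((T - a) * (T - p)⁻¹ - 1) := by
    field_simp
  rw [expand] at key2
  linarith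

/-- **Remaining-time bound from mutual levels.**  Under the hypotheses of `coexist_cost_le_feed` with `F ≥ 0` and
`c, c′ > 0`: `T − a ≤ (1 + ΛF(T−a)²/(cc′))(T − p)`.
[cite: Tao2016AveragedNS, §1.2 (dyadic model); elementary real analysis (door D4′ of stmt-21808)] -/
theorem remaining_time_le_of_levels {v w dv : ℝ → ℝ} {Λ F c c' T a p : ℝ} (hΛ : 0 < Λ) (hc : 0 < c)
    (hc' : 0 < c') (hF : 0 ≤ F) (hap : a ≤ p) (hpT : p < T)
    (hv : ∀ τ ∈ Icc a p, HasDerivAt v (dv τ) τ)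
    (hdv : ∀ τ ∈ Icc a p, dv τ ≤ F - Λ⁻¹ * v τ * w τ)
    (hlev : ∀ τ ∈ Icc a p, c / (T - τ) ≤ v τ) (hlev' : ∀ τ ∈ Icc a p, c' / (T - τ) ≤ w τ)
    (hend : v a ≤ v p) :
    T - a ≤ (1 + Λ * (F * (T - a) ^ 2) / (c * c')) * (T - p) := by
  have hTa : 0 < T - a := by linarith
  have hTp : 0 < T - p := by linarith
  have hcc : 0 < c * c' := mul_pos hc hc'
  have h := coexist_cost_le_feed hΛ hc.le hc'.le hap hpT hv hdv hlev hlev' hend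
  set x : ℝ := (T - a) / (T - p) with hxdef
  have hpa : F * (p - a) * (T - a) ≤ F * (T - a) ^ 2 := by
    have h1 : F * (p - a) ≤ F * (T - a) := mul_le_mul_of_nonneg_left (by linarith) hF
    calc F * (p - a) * (T - a) ≤ F * (T - a) * (T - a) := mul_le_mul_of_nonneg_right h1 hTa.le
      _ = F * (T - a) ^ 2 := by ring
  -- x - 1 ≤ Λ F (T-a)² / (c c')
  have h1 : x - 1 ≤ Λ * (F * (T - a) ^ 2) / (c * c') := by
    rw [le_div_iff₀ hcc]
    have h2 : Λ⁻¹ * c * c' * (x - 1) ≤ F * (T - a) ^ 2 := h.trans hpa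
    have h3 := mul_le_mul_of_nonneg_left h2 hΛ.le
    have e : Λ * (Λ⁻¹ * c * c' * (x - 1)) = (x - 1) * (c * c') := by field_simp
    rw [e] at h3
    linarith
  have hxe : T - a = x * (T - p) := by rw [hxdef, div_mul_cancel₀ _ hTp.ne']
  have hxle : x ≤ 1 + Λ * (F * (T - a) ^ 2) / (c * c') := by linarith
  calc T - a = x * (T - p) := hxe
    _ ≤ (1 + Λ * (F * (T - a) ^ 2) / (c * c')) * (T - p) := mul_le_mul_of_nonneg_right hxle hTp.le

/-- **Two fired shells cannot coexist with the lower one rising (dyadic cascade).**  Let `X` solve the dyadic law for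
shell `k` on `[a,p]` (`a ≤ p < T`, `Λ > 0`, `X ≥ 0` there), the shell below be past its peak (`Xₖ₋₁(τ) ≤ Xₖ₋₁(a)`)
with the type-I bound `Λᵏ⁻¹Xₖ₋₁(a)(T−a) ≤ K`, shells `k` and `k+1` hold the renormalised levels
`ΛᵏXₖ(τ)(T−τ) ≥ c > 0`, `Λᵏ⁺¹Xₖ₊₁(τ)(T−τ) ≥ c′ > 0`, and shell `k` not come down (`Xₖ(a) ≤ Xₖ(p)`).  Then
`T − a ≤ (1 + Λ²K²/(cc′))(T − p)`.
[cite: Tao2016AveragedNS, §1.2 (dyadic Katz–Pavlović model), §4 Lemma 4.1 (4.8); elementary (door D4′ of stmt-21808)] -/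
theorem dyadic_coexist_bottom_shell {X : ℤ → ℝ → ℝ} {k : ℤ} {Λ K c c' T a p : ℝ} (hΛ : 0 < Λ) (hc : 0 < c)
    (hc' : 0 < c') (hap : a ≤ p) (hpT : p < T)
    (hlawk : ∀ τ ∈ Icc a p,
      HasDerivAt (X k) (Λ ^ (k - 1) * X (k - 1) τ ^ 2 - Λ ^ k * X k τ * X (k + 1) τ) τ)
    (hnn : ∀ (j : ℤ), ∀ τ ∈ Icc a p, 0 ≤ X j τ)
    (hfeed : ∀ τ ∈ Icc a p, X (k - 1) τ ≤ X (k - 1) a)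
    (htypeI : Λ ^ (k - 1) * X (k - 1) a * (T - a) ≤ K)
    (hL : ∀ τ ∈ Icc a p, c ≤ Λ ^ k * X k τ * (T - τ))
    (hL' : ∀ τ ∈ Icc a p, c' ≤ Λ ^ (k + 1) * X (k + 1) τ * (T - τ))
    (hend : X k a ≤ X k p) :
    T - a ≤ (1 + Λ ^ 2 * K ^ 2 / (c * c')) * (T - p) := by
  have hTa : 0 < T - a := by linarith
  have hTp : 0 < T - p := by linarith
  have ha : a ∈ Icc a p := left_mem_Icc.2 hap
  have hΛ0 : Λ ≠ 0 := hΛ.ne'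
  set α : ℝ := Λ ^ (k - 1) with hα
  have hα0 : 0 < α := zpow_pos hΛ _
  have hk : Λ ^ k = α * Λ := by
    rw [hα, ← zpow_add_one₀ hΛ0, sub_add_cancel]
  have hk1 : Λ ^ (k + 1) = α * Λ * Λ := by
    rw [zpow_add_one₀ hΛ0, hk]
  set v : ℝ → ℝ := fun τ => Λ ^ k * X k τ with hvdef
  set w : ℝ → ℝ := fun τ => Λ ^ (k + 1) * X (k + 1) τ with hwdef
  set dv : ℝ → ℝ := fun τ => Λ ^ k * (Λ ^ (k - 1) * X (k - 1) τ ^ 2 - Λ ^ k * X k τ * X (k + 1) τ)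
    with hdvdef
  set F : ℝ := Λ * (α * X (k - 1) a) ^ 2 with hFdef
  have hF : 0 ≤ F := by positivity
  have hv : ∀ τ ∈ Icc a p, HasDerivAt v (dv τ) τ := fun τ hτ => (hlawk τ hτ).const_mul _
  have hdv : ∀ τ ∈ Icc a p, dv τ ≤ F - Λ⁻¹ * v τ * w τ := by
    intro τ hτ
    have h0 : 0 ≤ X (k - 1) τ := hnn _ τ hτ
    have h1 : X (k - 1) τ ≤ X (k - 1) a := hfeed τ hτ
    have hsq : X (k - 1) τ ^ 2 ≤ X (k - 1) a ^ 2 := pow_le_pow_left₀ h0 h1 2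
    have e1 : dv τ = Λ * (α * X (k - 1) τ) ^ 2 - Λ⁻¹ * v τ * w τ := by
      simp only [hdvdef, hvdef, hwdef, hk, hk1]
      field_simp
      ring
    rw [e1, hFdef]
    have : Λ * (α * X (k - 1) τ) ^ 2 ≤ Λ * (α * X (k - 1) a) ^ 2 := by
      apply mul_le_mul_of_nonneg_left _ hΛ.le
      rw [mul_pow, mul_pow]
      exact mul_le_mul_of_nonneg_left hsq (by positivity)
    linarith
  have hlev : ∀ τ ∈ Icc a p, c / (T - τ) ≤ v τ := by
    intro τ hτ
    have hTτ : 0 < T - τ := by linarith [hτ.2]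
    rw [div_le_iff₀ hTτ]
    exact hL τ hτ
  have hlev' : ∀ τ ∈ Icc a p, c' / (T - τ) ≤ w τ := by
    intro τ hτ
    have hTτ : 0 < T - τ := by linarith [hτ.2]
    rw [div_le_iff₀ hTτ]
    exact hL' τ hτ
  have hend' : v a ≤ v p := by
    simp only [hvdef]
    exact mul_le_mul_of_nonneg_left hend (zpow_pos hΛ _).le
  have h := remaining_time_le_of_levels hΛ hc hc' hF hap hpT hv hdv hlev hlev' hend'
  have hu0 : 0 ≤ α * X (k - 1) a * (T - a) := by
    have := hnn (k - 1) a ha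
    positivity
  have hFK : F * (T - a) ^ 2 ≤ Λ * K ^ 2 := by
    have e : F * (T - a) ^ 2 = Λ * (α * X (k - 1) a * (T - a)) ^ 2 := by rw [hFdef]; ring
    rw [e]
    exact mul_le_mul_of_nonneg_left (pow_le_pow_left₀ hu0 htypeI 2) hΛ.le
  have hcc : 0 < c * c' := mul_pos hc hc'
  calc T - a ≤ (1 + Λ * (F * (T - a) ^ 2) / (c * c')) * (T - p) := h
    _ ≤ (1 + Λ ^ 2 * K ^ 2 / (c * c')) * (T - p) := by
        apply mul_le_mul_of_nonneg_right _ hTp.le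
        have : Λ * (F * (T - a) ^ 2) / (c * c') ≤ Λ ^ 2 * K ^ 2 / (c * c') := by
          rw [div_le_div_iff_of_pos_right hcc]
          nlinarith
        linarith

/-- **(S) from the leading edge.**  In renormalised units `Wⱼ = ΛʲXⱼ(τ)(T−τ)`: if shell `k` holds `Wₖ ≥ c ≥ 0` and the two
shells above are small, `0 ≤ Wₖ₊₁ ≤ c₁`, `0 ≤ Wₖ₊₂ ≤ c₂` with `c₁c₂ ≤ Λ²c²/2` (`Λ > 0`, `τ < T`), then the look-ahead
bound `ΛXₖ₊₁Xₖ₊₂ ≤ Xₖ²/2` of `dyadic_peak_delay_bottom_shell` holds at `τ`.  (With the tree's leading edge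
`c₁ = c₀`, `c₂ = Λc₀²` before the first firing of shell `k+1`, and `c = c₀`: the condition is `c₀ ≤ Λ/2`.)
[cite: Tao2016AveragedNS, §1.2 (dyadic model); elementary (door D4′ of stmt-21808)] -/
theorem lookahead_of_leadingEdge {X : ℤ → ℝ → ℝ} {k : ℤ} {Λ c c₁ c₂ T τ : ℝ} (hΛ : 0 < Λ) (hc : 0 ≤ c)
    (hτT : τ < T) (hcc : c₁ * c₂ ≤ Λ ^ 2 * c ^ 2 / 2)
    (h1nn : 0 ≤ X (k + 1) τ) (h2nn : 0 ≤ X (k + 2) τ)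
    (hk : c ≤ Λ ^ k * X k τ * (T - τ))
    (hk1 : Λ ^ (k + 1) * X (k + 1) τ * (T - τ) ≤ c₁)
    (hk2 : Λ ^ (k + 2) * X (k + 2) τ * (T - τ) ≤ c₂) :
    Λ * X (k + 1) τ * X (k + 2) τ ≤ X k τ ^ 2 / 2 := by
  have hTτ : 0 < T - τ := by linarith
  have hΛ0 : Λ ≠ 0 := hΛ.ne'
  set α : ℝ := Λ ^ k with hα
  have hα0 : 0 < α := zpow_pos hΛ _
  have hk1e : Λ ^ (k + 1) = α * Λ := by rw [hα, zpow_add_one₀ hΛ0]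
  have hk2e : Λ ^ (k + 2) = α * Λ * Λ := by
    rw [show k + 2 = k + 1 + 1 by ring, zpow_add_one₀ hΛ0, hk1e]
  rw [hk1e] at hk1
  rw [hk2e] at hk2
  -- products of the two small shells
  have hA0 : 0 ≤ α * Λ * X (k + 1) τ * (T - τ) := by positivity
  have hB0 : 0 ≤ α * Λ * Λ * X (k + 2) τ * (T - τ) := by positivity
  have hprod : (α * Λ * X (k + 1) τ * (T - τ)) * (α * Λ * Λ * X (k + 2) τ * (T - τ)) ≤ c₁ * c₂ :=
    mul_le_mul hk1 hk2 hB0 (hA0.trans hk1)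
  have hsq : c ^ 2 ≤ (α * X k τ * (T - τ)) ^ 2 := pow_le_pow_left₀ hc hk 2
  have hmain : (α * Λ * X (k + 1) τ * (T - τ)) * (α * Λ * Λ * X (k + 2) τ * (T - τ))
      ≤ Λ ^ 2 * (α * X k τ * (T - τ)) ^ 2 / 2 := by
    have : Λ ^ 2 * c ^ 2 / 2 ≤ Λ ^ 2 * (α * X k τ * (T - τ)) ^ 2 / 2 := by
      have hΛ2 : 0 ≤ Λ ^ 2 := by positivity
      nlinarith
    linarith
  -- divide by the common positive factor α² Λ² (T-τ)²
  have hpos : 0 < α ^ 2 * Λ ^ 2 * (T - τ) ^ 2 := by positivity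
  have e1 : (α * Λ * X (k + 1) τ * (T - τ)) * (α * Λ * Λ * X (k + 2) τ * (T - τ))
      = (α ^ 2 * Λ ^ 2 * (T - τ) ^ 2) * (Λ * X (k + 1) τ * X (k + 2) τ) := by ring
  have e2 : Λ ^ 2 * (α * X k τ * (T - τ)) ^ 2 / 2 = (α ^ 2 * Λ ^ 2 * (T - τ) ^ 2) * (X k τ ^ 2 / 2) := by ring
  rw [e1, e2] at hmain
  exact le_of_mul_le_mul_left hmain hpos

end WakeRatchetPeakDelaySelfDrain

end Summit.NavierStokesRegularity.NavierStokesRegularity.Theorems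

end
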